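import Summits.QuantumFields.YangMills.Theorems.UnitScaleTiltProp8HalvingELMinimalitySU2
import Literature.MathematicalPhysics.QuantumFieldTheory.Balaban1983to89.T3PrintedRegularMinimiser
import Literature.MathematicalPhysics.QuantumFieldTheory.Balaban1983to89.T4WilsonGaugeFlatDirection
import HarnessLib

/-!
# Route `UnitScaleTilt`, crux K1 child «MinimiserStabilityRegPr» (stmt-QuantumFields-19200), registered stub V2′ `stub_halvingStep`
# (skeletons v8 5b4e846794b80374 ∕ v10 `BirthV10`) — **THE CHART-AGNOSTIC HALF OF THE `hcrit` JUNCTION** (owner row M3 «(P1) … with its `hcrit` junction»: from the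
# package's `hcrit : IsMinOn wilsonAction4 (regFibrePr …) U` to the `hmin : IsMinOn (X ↦ wilsonAction4 (Φ X)) T_𝔰𝔲 A′` of the (i)-suppliers
# ✓ `HalvingELMinimalitySU2.tracePairing_of_isMinOn_su2` ∕ ✓ `HalvingDressedCriticalitySU2.tracePairing_of_isMinOn_dressed_wilson_su2`, through an ABSTRACT chart `Φ`
# carrying two DISPLAYED properties — so that whatever chart DESIGN CONSTRAINT D-P1 (RULING g26-№13) fixes, the junction is by `exact`)

Cell `ym3-torus` (HUMAN RULING D-0037, YM ladder rung R3 — continuum SU(2) YM₃ on the torus is a RUNG, not the Clay problem), width seat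
`ym-ust-19200-w7` gen 0 (D-0154 (3c)).  `--supports stmt-QuantumFields-19200 --as helper`; def-free, 0 sorry, standard axioms.

THE PRINT ([Balaban1985Variational] p. 301): *«The configuration U′_k is a minimum of the functional (5) in the space (6) with V′ instead of V, hence it is a minimum of this
functional in the space (150), because this space is defined by more restrictive functional conditions and a sufficiently small neighborhood of U′_k in (150) is contained
in (6)»*; p. 302: *«Of course we can apply these transformations to all configurations in the space (150) … The image of U′_k is a minimum of 𝔊(A′)»*.  In the tree: the
package hypothesis `hcrit` (the minimiser `U` of `wilsonAction4` over the regular fibre `regFibrePr F n K hnK ε₀ V`), a chart `Φ : (bonds → M₂(ℂ)) → SU(2)-fields` on the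
competitor set `T` (print's (150) read in the coordinates `A′` of (157)), the two facts print uses — (Φ-1) «`Φ` maps `T` into the regular fibre» ((48): the chart preserves the
averages; (150) ⊂ (6) near the minimiser) and (Φ-2) «`Φ A′` is a gauge copy of `U`» ([B8] Thm 2: `U^{u} = e^{iηA}`, `A = A′ − HD(A′)`) — and the gauge invariance of the Wilson
action (`T4WilsonGaugeFlatDirection.wilsonAction_gaugeAct`) give `hmin`.

WHAT THIS FILE PROVES (no definition, no sorry):
* §1 `isMinOn_comp_of_mapsTo` — minimality transfers through any map into the admissible set whose value at the base point does not exceed the minimum (pure order theory).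
* §2 ★★ **`hmin_of_hcrit`** — d = 3 carrier: `hcrit` ∧ (Φ-1) ∧ (Φ-2) ⟹ `IsMinOn (fun X => wilsonAction4 (Φ X)) T A′`, for ANY `T`, `Φ`, gauge transformation `u` — the `hmin`
  binder of the `_su2` suppliers (take `T := T_𝔰𝔲`), with (Φ-1), (Φ-2) DISPLAYED; `hmin_of_hcrit_eq` — the variant with `Φ A′ = U` literally.
HONEST SCOPE.  Bookkeeping; the chart `Φ` and its two properties are hypotheses — (Φ-1) is P3a♭'s (48) + the neighbourhood inclusion (150) ⊂ (6) (D-P1-dependent: which averaged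
gauge condition makes the fibre identity hold for the symmetrised average), (Φ-2) is pillar P1's GLOBAL chart identity ([B8] Thm 2 on `Ω″₀ = T`; the package's (P1-chart)
clause is its restriction to the layer).  NOT a claim about the stub, the crux, the rung or the mass gap.

References: T. Bałaban, CMP **102** (1985) 277–309 [Balaban1985Variational] (5)–(6) p.278, (150) p.301, (157)–(158) p.302; CMP **99** (1985) 75–102 [Balaban1985RegularSpaces]
Thm 2 p.83.
-/

set_option autoImplicit false

noncomputable section

open scoped BigOperators Matrix.Norms.L2Operator

namespace Summit.QuantumFields.YangMills.Theorems.HalvingHcritTransfer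

open Literature.MathematicalPhysics.QuantumFieldTheory.Balaban1983to89
open Literature.MathematicalPhysics.QuantumFieldTheory.Balaban1983to89.T3PrintedRegularMinimiser (regFibrePr)
open T3ContinuumYM3Torus (T3Family)
open T4WilsonGaugeFlatDirection (wilsonAction_gaugeAct)

/-! ## §1 Minimality transfers through a map into the admissible set -/

section Order

variable {α β : Type*}

/-- **MINIMALITY TRANSFERS THROUGH A MAP INTO THE ADMISSIBLE SET**: if `U` minimises `S` over `F`, `Φ` maps `T` into `F`, and `S (Φ A) ≤ S U`, then `A` minimises `S ∘ Φ` over `T`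
(print p. 301: «a minimum … in the space (150), because this space is defined by more restrictive functional conditions»). [cite: Balaban1985Variational, (150) p.301] -/
theorem isMinOn_comp_of_mapsTo (S : β → ℝ) {F : Set β} {T : Set α} (Φ : α → β) {U : β} {A : α}
    (hmin : IsMinOn S F U) (hΦ : Set.MapsTo Φ T F) (hA : S (Φ A) ≤ S U) : IsMinOn (fun X => S (Φ X)) T A := by
  intro X hX
  have h := hmin (hΦ hX)
  simp only [Set.mem_setOf_eq] at h ⊢
  exact hA.trans h

end Order

/-! ## §2 The `hmin` binder of the 𝔰𝔲(2) suppliers from the package's `hcrit` -/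

section Carrier

variable {F : T3Family} {n K : ℕ}

/-- ★★ **`hmin` FROM `hcrit` THROUGH AN ABSTRACT CHART** (d = 3 carrier): if `U` minimises the Wilson action over the regular fibre `regFibrePr F n K hnK ε₀ V` (the package's
`hcrit`), the chart `Φ` maps the competitor set `T` into that fibre (Φ-1), and `Φ A′` is the gauge copy `u • U` (Φ-2), then `A′` minimises `X ↦ wilsonAction4 (Φ X)` over `T` — the
`hmin` of `HalvingELMinimalitySU2.tracePairing_of_isMinOn_su2` ∕ `HalvingDressedCriticalitySU2.tracePairing_of_isMinOn_dressed_wilson_su2` (any `T`, in particular `T_𝔰𝔲`; `A′ ∈ T`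
is not even needed for the transfer). [cite: Balaban1985Variational, (5)-(6) p.278, (150) p.301, (157)-(158) p.302; Balaban1985RegularSpaces, Thm 2 p.83] -/
theorem hmin_of_hcrit (hnK : n ≤ K) (ε₀ : ℝ) (V : GaugeField (F.P n) 0 (Matrix.specialUnitaryGroup (Fin 2) ℂ))
    {U : GaugeField (F.P K) 0 (Matrix.specialUnitaryGroup (Fin 2) ℂ)}
    (hcrit : IsMinOn (fun W : GaugeField (F.P K) 0 (Matrix.specialUnitaryGroup (Fin 2) ℂ) => wilsonAction4 W) (regFibrePr F n K hnK ε₀ V) U)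
    (T : Set (PBond (F.P K) 0 → Matrix (Fin 2) (Fin 2) ℂ))
    (Φ : (PBond (F.P K) 0 → Matrix (Fin 2) (Fin 2) ℂ) → GaugeField (F.P K) 0 (Matrix.specialUnitaryGroup (Fin 2) ℂ))
    (hΦ : ∀ X ∈ T, Φ X ∈ regFibrePr F n K hnK ε₀ V)
    {A' : PBond (F.P K) 0 → Matrix (Fin 2) (Fin 2) ℂ} (u : GaugeTransf (F.P K) 0 (Matrix.specialUnitaryGroup (Fin 2) ℂ))
    (hΦA : Φ A' = GaugeField.gaugeAct u U) :
    IsMinOn (fun X => wilsonAction4 (Φ X)) T A' := by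
  refine isMinOn_comp_of_mapsTo (fun W : GaugeField (F.P K) 0 (Matrix.specialUnitaryGroup (Fin 2) ℂ) => wilsonAction4 W) Φ hcrit (fun X hX => hΦ X hX) (le_of_eq ?_)
  show wilsonAction4 (Φ A') = wilsonAction4 U
  rw [hΦA]
  exact wilsonAction_gaugeAct 1 u U

/-- the variant with the chart hitting the minimiser literally (`Φ A′ = U`, e.g. after replacing `U` by its gauge copy inside the fibre). [cite: Balaban1985Variational, (150) p.301, (157) p.302] -/
theorem hmin_of_hcrit_eq (hnK : n ≤ K) (ε₀ : ℝ) (V : GaugeField (F.P n) 0 (Matrix.specialUnitaryGroup (Fin 2) ℂ))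
    {U : GaugeField (F.P K) 0 (Matrix.specialUnitaryGroup (Fin 2) ℂ)}
    (hcrit : IsMinOn (fun W : GaugeField (F.P K) 0 (Matrix.specialUnitaryGroup (Fin 2) ℂ) => wilsonAction4 W) (regFibrePr F n K hnK ε₀ V) U)
    (T : Set (PBond (F.P K) 0 → Matrix (Fin 2) (Fin 2) ℂ))
    (Φ : (PBond (F.P K) 0 → Matrix (Fin 2) (Fin 2) ℂ) → GaugeField (F.P K) 0 (Matrix.specialUnitaryGroup (Fin 2) ℂ))
    (hΦ : ∀ X ∈ T, Φ X ∈ regFibrePr F n K hnK ε₀ V)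
    {A' : PBond (F.P K) 0 → Matrix (Fin 2) (Fin 2) ℂ} (hΦA : Φ A' = U) :
    IsMinOn (fun X => wilsonAction4 (Φ X)) T A' :=
  isMinOn_comp_of_mapsTo (fun W : GaugeField (F.P K) 0 (Matrix.specialUnitaryGroup (Fin 2) ℂ) => wilsonAction4 W) Φ hcrit (fun X hX => hΦ X hX) (by rw [hΦA])

end Carrier

end Summit.QuantumFields.YangMills.Theorems.HalvingHcritTransfer

end
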